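import Literature.Analysis.FluidPDE.KwonTestField
import Literature.Analysis.FluidPDE.CaloricRemainderCalculus
import HarnessLib

/-!
# Calculus of Kwon's test fields: derivatives of `ξ ↦ ζ_ξ`, and the space–time test fields
# `(t, x) ↦ ζ_{ξ(t,·)}(x)`

Analysis/FluidPDE file on the discharge path of the named fact
`Literature.Analysis.FluidPDE.kwon2023_velocity_epsilon_regularity`
(`PressureFreeEpsilonRegularity.lean`; H. Kwon, J. Differential Equations (2023) =
arXiv:2104.03160, Thm. 1.4), fourth brick of Lemma 2.5 after `KwonHarmonicPart.lean`,
`KwonTestField.lean`, `KwonLocalLerayDuality.lean`. The equation of the principal part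
`v = u − h` is obtained "rigorously by testing (NS) with `−curl(φ curl Δ⁻¹ξ)` for any
`ξ ∈ C_c^∞((−4,0) × B₁)`" (proof of Lemma 2.5, arXiv p. 8): one inserts the space–time field
`Z(t, x) = ζ_{ξ(t,·)}(x)` (`ζ_ξ = Kwon2023.testField ξ = −curl(φ curl (N ⋆ ξ))`) into the weak
formulation of Navier–Stokes on `Q₂` and moves `∂ₜ`, `(u·∇)`, `Δ` from `Z` back onto `ξ`. This file
supplies the calculus for that:

* derivatives fall on the test field in the potential `A_ξ = N ⋆ ξ`:
  `∂ₐ A_ξ = A_{∂ₐξ}` (`fderiv_testPotential_apply`), `Δ A_ξ = A_{Δξ}`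
  (`laplacian_testPotential_eq`), smoothness without support conditions
  (`contDiff_testPotential_nat/infty`), linearity over finite sums;
* **commutators with the test-field map**: `∂ₐ ζ_ξ = ζ_{∂ₐξ} − curl((∂ₐφ) curl A_ξ)`
  (`fderiv_testField_apply`) and `Δ ζ_ξ = ζ_{Δξ} − curl(2 D(curl A_ξ)(∇φ) + (Δφ) curl A_ξ)`
  (`laplacian_testField`) — the error terms are carried by `∇φ`, `Δφ`, i.e. live on the annulus
  `5/4 ≤ |x| ≤ 7/4` where `A_ξ = k ⋆ ξ` is given by the smooth annular kernel (`KwonTestField`);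
  they are Kwon's terms `2 curl Δ⁻¹ div(curl u ⊗ ∇φ) − curl Δ⁻¹(Δφ curl u)` ((err.Deu), p. 8) and
  the `∇φ`-terms of the convective part, read on the test side;
* **space–time test fields**: for `Ξ ∈ C_c^∞(ℝ × ℝ³; ℝ³)` the slicewise potential
  `(t, x) ↦ A_{Ξ(t,·)}(x)` and test field `(t, x) ↦ ζ_{Ξ(t,·)}(x)` are jointly smooth
  (`contDiff_uncurry_testPotential_slice`, Mathlib's `contDiffOn_convolution_right_with_param`;
  `contDiff_uncurry_testField_slice` via the tree's `IsSmoothSpaceTimeOn` calculus), the time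
  derivative falls on `Ξ`: `∂ₜ A_{Ξ(t,·)} = A_{∂ₜΞ(t,·)}` (`timeDeriv_testPotential_slice`,
  dominated differentiation under the integral) and **`∂ₜ ζ_{Ξ(t,·)} = ζ_{∂ₜΞ(t,·)}`**
  (`timeDeriv_testField_slice`, exchange of `∂ₜ` with spatial derivatives, Schwarz), the support
  lies in `(time projection of supp Ξ) × B̄_{7/4}` (`tsupport_uncurry_testField_slice_subset`), and
  for `Ξ ∈ C_c^∞((a,b) × U)` the field `Z` is a space–time test field on `(a,b) × B₂`
  (`isSpaceTimeTestOn_testField_slice`) — admissible in `IsDistributionalNSSolutionOn` on `Q₂`.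

Deliberately NOT here (next files): the kernel ("transpose") form of the commutator terms as
bounded fields built from `u` on `B₁` (Kwon's `f`), the slicing of the suitable weak solution, and
the space–time weak identity for `v`.

## Mathlib / tree search

Tree (reused): `fderiv_integral_smul_comp_sub_apply`, `contDiff_integral_smul_comp_sub`,
`integrable_smul_comp_sub` (`HarmonicProbe`); `curl_fderiv_apply`, `fderiv_curl`,
`curl_laplacian`, `curl_add`, `curl_smul`, `contDiff_curl`, `curl_eq_curlCLM` (`VorticityCalculus`,
`TaoEnstrophyLocalisation(Proofs)`); `laplacian_smul_field` (`CaloricRemainderCalculus`),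
`contDiff_laplacian` (`NewtonKernel`), `laplacian_eq_sum_fderiv_fderiv_normed`,
`IsSpaceTimeTestOn.timeDeriv_top`, `.exists_norm_le` (`HeatDuhamelBack`),
`IsSpaceTimeTestOn.exists_compact_slice_subset` (`ClassicalSolutionCalculus`), the
`IsSmoothSpaceTimeOn` calculus `isSmoothSpaceTimeOn_fderiv_of_isOpen`, `.clm`, `.smul`,
`hasDerivAt_fderiv_slice_clm`, `hasDerivAt_timeLine`, `isSmoothSpaceTimeOn_const_time`
(`SpaceTimeCalculus`); pattern of `contDiff_uncurry_newtonNearPotential_slice`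
(`NewtonTestPotential`, scalar version). Mathlib: `contDiffOn_convolution_right_with_param`,
`hasDerivAt_integral_of_dominated_loc_of_deriv_le`, `InnerProductSpace.laplacian_smul`.
`lean search 'timeDeriv.*testField|testPotential.*slice'`: nothing (2026-08-17).

## References

* H. Kwon, J. Differential Equations (2023) = arXiv:2104.03160: proof of Lemma 2.5 (arXiv p. 8),
  (err.Deu). [Kwon2023RolePressure]
* L. C. Evans, *Partial Differential Equations*, 2nd ed. (2010), App. C.1–C.2 (exchange of partial
  derivatives, differentiation under the integral sign). [Evans2010]
-/

noncomputable section

open MeasureTheory Set Function Filter Topology TopologicalSpace Metric InnerProductSpace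
  ContinuousLinearMap
open scoped NNReal ENNReal RealInnerProductSpace Convolution Laplacian ContDiff

namespace Literature.Analysis.FluidPDE

namespace Kwon2023

variable {ξ : EuclideanSpace ℝ (Fin 3) → EuclideanSpace ℝ (Fin 3)}

/-! ### The potential as a kernel integral; derivatives fall on the test field -/

/-- The test-side kernel vanishes off `|z| ≤ 4`. [folklore] -/
theorem testKernel_eq_zero_of_lt {z : EuclideanSpace ℝ (Fin 3)} (hz : 4 < ‖z‖) : testKernel z = 0 :=
  newtonNear_eq_zero (by norm_num) (by norm_num) hz.le

variable (ξ) in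
/-- `A(x) = ∫ N(z) ξ(x − z) dz`. [folklore] -/
theorem testPotential_eq_integral (x : EuclideanSpace ℝ (Fin 3)) :
    testPotential ξ x = ∫ z, testKernel z • ξ (x - z) := by
  rw [testPotential, convolution_lsmul]

variable (ξ) in
/-- `A = (x ↦ ∫ N(z) ξ(x − z) dz)` as functions. [folklore] -/
theorem testPotential_eq_integral' : testPotential ξ = fun x => ∫ z, testKernel z • ξ (x - z) :=
  funext (testPotential_eq_integral ξ)

/-- `A ∈ Cᵏ` for `ξ ∈ Cᵏ`, `k ∈ ℕ` (no support condition on `ξ`: the kernel is `L¹` and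
vanishes off a ball). [folklore] -/
theorem contDiff_testPotential_nat {k : ℕ} (hξ : ContDiff ℝ k ξ) :
    ContDiff ℝ k (testPotential ξ) := by
  rw [testPotential_eq_integral']
  exact contDiff_integral_smul_comp_sub integrable_testKernel
    (fun z hz => testKernel_eq_zero_of_lt hz) k hξ

/-- `A ∈ C^∞` (in every `Cⁿ`) for `ξ ∈ C^∞`, without support condition on `ξ`. [folklore] -/
theorem contDiff_testPotential_infty (hξ : ContDiff ℝ ∞ ξ) {n : ℕ∞} :
    ContDiff ℝ n (testPotential ξ) :=
  (contDiff_infty.2 fun k => contDiff_testPotential_nat (contDiff_infty.1 hξ k)).of_le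
    (by exact_mod_cast le_top)

/-- `curl A ∈ Cⁿ` for `ξ ∈ C^∞`. [folklore] -/
theorem contDiff_curl_testPotential (hξ : ContDiff ℝ ∞ ξ) {n : ℕ∞} :
    ContDiff ℝ n (curl (testPotential ξ)) :=
  contDiff_curl (contDiff_testPotential_infty hξ)

/-- `∂ₐξ ∈ C^∞` for `ξ ∈ C^∞`. [folklore] -/
theorem contDiff_fderiv_apply_infty (hξ : ContDiff ℝ ∞ ξ) (a : EuclideanSpace ℝ (Fin 3)) :
    ContDiff ℝ ∞ fun y => fderiv ℝ ξ y a :=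
  (hξ.fderiv_right (m := (⊤ : ℕ∞)) (by exact_mod_cast le_top)).clm_apply contDiff_const

/-- `A_0 = 0`. [folklore] -/
@[simp]
theorem testPotential_zero :
    testPotential (0 : EuclideanSpace ℝ (Fin 3) → EuclideanSpace ℝ (Fin 3)) = 0 := by
  funext x
  rw [testPotential_eq_integral]
  simp

/-- **Derivatives fall on the test field**: `∂ₐ A_ξ = A_{∂ₐ ξ}` for `ξ ∈ C¹`
(differentiation under the integral against the `L¹` kernel). [folklore] -/
theorem fderiv_testPotential_apply (hξ : ContDiff ℝ 1 ξ) (x a : EuclideanSpace ℝ (Fin 3)) :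
    fderiv ℝ (testPotential ξ) x a = testPotential (fun y => fderiv ℝ ξ y a) x := by
  rw [testPotential_eq_integral', fderiv_integral_smul_comp_sub_apply integrable_testKernel
    (fun z hz => testKernel_eq_zero_of_lt hz) hξ x a, testPotential_eq_integral]

/-- Function form of `fderiv_testPotential_apply`. [folklore] -/
theorem fderiv_testPotential_apply' (hξ : ContDiff ℝ 1 ξ) (a : EuclideanSpace ℝ (Fin 3)) :
    (fun x => fderiv ℝ (testPotential ξ) x a) = testPotential (fun y => fderiv ℝ ξ y a) :=
  funext fun x => fderiv_testPotential_apply hξ x a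

/-- Linearity of `ξ ↦ A_ξ` over finite sums of continuous fields. [folklore] -/
theorem testPotential_finset_sum {ι : Type*} (s : Finset ι)
    {g : ι → EuclideanSpace ℝ (Fin 3) → EuclideanSpace ℝ (Fin 3)} (hg : ∀ i ∈ s, Continuous (g i))
    (x : EuclideanSpace ℝ (Fin 3)) :
    testPotential (fun y => ∑ i ∈ s, g i y) x = ∑ i ∈ s, testPotential (g i) x := by
  simp only [testPotential_eq_integral, Finset.smul_sum]
  rw [integral_finsetSum]
  intro i hi
  exact integrable_smul_comp_sub integrable_testKernel (fun z hz => testKernel_eq_zero_of_lt hz)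
    (hg i hi) x

/-- **The Laplacian falls on the test field**: `Δ A_ξ = A_{Δξ}` everywhere, for `ξ ∈ C²`
(`Δ = Σᵢ ∂ᵢ∂ᵢ` and `fderiv_testPotential_apply` twice). [folklore] -/
theorem laplacian_testPotential_eq (hξ : ContDiff ℝ 2 ξ) (x : EuclideanSpace ℝ (Fin 3)) :
    (Δ (testPotential ξ)) x = testPotential (Δ ξ) x := by
  set b := stdOrthonormalBasis ℝ (EuclideanSpace ℝ (Fin 3)) with hb
  have hA : ContDiff ℝ 2 (testPotential ξ) := contDiff_testPotential_nat (k := 2) hξ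
  have hξ1 : ContDiff ℝ 1 ξ := hξ.of_le one_le_two
  have hdi : ∀ i, ContDiff ℝ 1 fun y => fderiv ℝ ξ y (b i) := fun i =>
    (hξ.fderiv_right (m := 1) le_rfl).clm_apply contDiff_const
  rw [laplacian_eq_sum_fderiv_fderiv_normed b hA x]
  have e1 : ∀ i, fderiv ℝ (fun y => fderiv ℝ (testPotential ξ) y (b i)) x (b i) =
      testPotential (fun y => fderiv ℝ (fun z => fderiv ℝ ξ z (b i)) y (b i)) x := fun i => by
    rw [fderiv_testPotential_apply' hξ1 (b i), fderiv_testPotential_apply (hdi i) x (b i)]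
  simp only [e1]
  rw [← testPotential_finset_sum _ (fun i _ =>
    (((hdi i).fderiv_right (m := 0) le_rfl).clm_apply contDiff_const).continuous)]
  congr 1
  funext y
  rw [laplacian_eq_sum_fderiv_fderiv_normed b hξ y]

/-! ### Derivatives of the test field `ζ_ξ = −curl(φ curl A_ξ)` -/

/-- `ζ_0 = 0`. [folklore] -/
@[simp]
theorem testField_zero :
    testField (0 : EuclideanSpace ℝ (Fin 3) → EuclideanSpace ℝ (Fin 3)) = 0 := by
  funext x
  rw [testField, testPotential_zero]
  simp

/-- **Spatial derivatives of the test field**: for `ξ ∈ C^∞`,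
`∂ₐ ζ_ξ = ζ_{∂ₐξ} − curl((∂ₐφ) curl A_ξ)` — the derivative commutes with `ξ ↦ ζ_ξ` up to a term
carried by `∇φ`, i.e. supported on the annulus `5/4 ≤ |x| ≤ 7/4` (Leibniz for `φ curl A` and
`∂ₐ A_ξ = A_{∂ₐξ}`). [folklore] -/
theorem fderiv_testField_apply (hξ : ContDiff ℝ ∞ ξ) (x a : EuclideanSpace ℝ (Fin 3)) :
    fderiv ℝ (testField ξ) x a =
      testField (fun y => fderiv ℝ ξ y a) x
        - curl (fun y => fderiv ℝ kwonCutoff y a • curl (testPotential ξ) y) x := by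
  have hξa : ContDiff ℝ ∞ fun y => fderiv ℝ ξ y a := contDiff_fderiv_apply_infty hξ a
  have hA2 : ContDiff ℝ 2 (testPotential ξ) := contDiff_testPotential_infty hξ
  have hcurlA1 : ContDiff ℝ 1 (curl (testPotential ξ)) := contDiff_curl_testPotential hξ
  have hcurlA'1 : ContDiff ℝ 1 (curl (testPotential fun y => fderiv ℝ ξ y a)) :=
    contDiff_curl_testPotential hξa
  set F : EuclideanSpace ℝ (Fin 3) → EuclideanSpace ℝ (Fin 3) :=
    fun y => kwonCutoff y • curl (testPotential ξ) y with hF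
  have hF2 : ContDiff ℝ 2 F := contDiff_kwonCutoff.smul (contDiff_curl_testPotential hξ)
  -- `ζ_ξ = -curl F`
  have hζ : testField ξ = fun y => -curl F y := by
    funext y; rw [testField]
  -- `∂ₐ F = (∂ₐφ) curl A + φ curl A_{∂ₐξ}`
  set G₁ : EuclideanSpace ℝ (Fin 3) → EuclideanSpace ℝ (Fin 3) :=
    fun y => fderiv ℝ kwonCutoff y a • curl (testPotential ξ) y with hG₁
  set G₂ : EuclideanSpace ℝ (Fin 3) → EuclideanSpace ℝ (Fin 3) :=
    fun y => kwonCutoff y • curl (testPotential fun z => fderiv ℝ ξ z a) y with hG₂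
  have hdF : (fun y => fderiv ℝ F y a) = fun y => G₁ y + G₂ y := by
    funext y
    have hφd : DifferentiableAt ℝ kwonCutoff y :=
      (contDiff_kwonCutoff (n := 1)).differentiable one_ne_zero y
    have hcd : DifferentiableAt ℝ (curl (testPotential ξ)) y := hcurlA1.differentiable one_ne_zero y
    rw [hF, fderiv_fun_smul hφd hcd, _root_.add_apply, _root_.smul_apply,
      ContinuousLinearMap.smulRight_apply,
      ← curl_fderiv_apply hA2 y a, fderiv_testPotential_apply' (hξ.of_le (by exact_mod_cast le_top))
        a, hG₁, hG₂, add_comm]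
  have hφa1 : ContDiff ℝ 1 fun y => fderiv ℝ kwonCutoff y a :=
    ((contDiff_kwonCutoff (n := 2)).fderiv_right (m := 1) le_rfl).clm_apply contDiff_const
  have hG₁d : ∀ y, DifferentiableAt ℝ G₁ y := fun y =>
    ((hφa1.smul hcurlA1).differentiable one_ne_zero) y
  have hG₂d : ∀ y, DifferentiableAt ℝ G₂ y := fun y =>
    (((contDiff_kwonCutoff (n := 1)).smul hcurlA'1).differentiable one_ne_zero) y
  rw [hζ, fderiv_fun_neg, _root_.neg_apply, ← curl_fderiv_apply hF2 x a, hdF,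
    curl_add (hG₁d x) (hG₂d x), testField]
  abel

/-- **The Laplacian of the test field**: for `ξ ∈ C^∞`,
`Δ ζ_ξ = ζ_{Δξ} − curl(2 D(curl A_ξ)(∇φ) + (Δφ) curl A_ξ)` — the Laplacian commutes with
`ξ ↦ ζ_ξ` up to a term carried by `∇φ, Δφ`, supported on the annulus (`curl Δ = Δ curl`,
Leibniz for `Δ(φ curl A)`, `Δ curl A_ξ = curl A_{Δξ}`). [folklore] -/
theorem laplacian_testField (hξ : ContDiff ℝ ∞ ξ) (x : EuclideanSpace ℝ (Fin 3)) :
    (Δ (testField ξ)) x =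
      testField (Δ ξ) x
        - curl (fun y => (2 : ℝ) • fderiv ℝ (curl (testPotential ξ)) y (gradient kwonCutoff y)
            + ((Δ kwonCutoff) y) • curl (testPotential ξ) y) x := by
  have hΔξ : ContDiff ℝ ∞ (Δ ξ) := contDiff_laplacian (n := (⊤ : ℕ∞)) (by exact_mod_cast hξ)
  have hA3 : ContDiff ℝ 3 (testPotential ξ) := contDiff_testPotential_infty hξ
  have hcurlA2 : ContDiff ℝ 2 (curl (testPotential ξ)) := contDiff_curl_testPotential hξ
  have hcurlA'1 : ContDiff ℝ 1 (curl (testPotential (Δ ξ))) := contDiff_curl_testPotential hΔξ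
  set F : EuclideanSpace ℝ (Fin 3) → EuclideanSpace ℝ (Fin 3) :=
    fun y => kwonCutoff y • curl (testPotential ξ) y with hF
  have hF3 : ContDiff ℝ 3 F := contDiff_kwonCutoff.smul (contDiff_curl_testPotential hξ)
  have hζ : testField ξ = fun y => -curl F y := by
    funext y; rw [testField]
  -- `Δ F = φ curl A_{Δξ} + W`
  set W : EuclideanSpace ℝ (Fin 3) → EuclideanSpace ℝ (Fin 3) :=
    fun y => (2 : ℝ) • fderiv ℝ (curl (testPotential ξ)) y (gradient kwonCutoff y)
      + ((Δ kwonCutoff) y) • curl (testPotential ξ) y with hW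
  set G : EuclideanSpace ℝ (Fin 3) → EuclideanSpace ℝ (Fin 3) :=
    fun y => kwonCutoff y • curl (testPotential (Δ ξ)) y with hG
  have hΔcurl : Δ (curl (testPotential ξ)) = curl (testPotential (Δ ξ)) := by
    funext y
    rw [← curl_laplacian hA3 y]
    congr 1
    funext z
    exact laplacian_testPotential_eq (contDiff_infty.1 hξ 2) z
  have hΔF : Δ F = fun y => G y + W y := by
    funext y
    rw [hF, laplacian_smul_field (contDiff_kwonCutoff (n := 2)) hcurlA2 y, hΔcurl, hG, hW]
    abel
  have hGd : ∀ y, DifferentiableAt ℝ G y := fun y =>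
    (((contDiff_kwonCutoff (n := 1)).smul hcurlA'1).differentiable one_ne_zero) y
  have hgradφ : ContDiff ℝ 1 (gradient kwonCutoff) :=
    (InnerProductSpace.toDual ℝ (EuclideanSpace ℝ (Fin 3))).symm.contDiff.comp
      ((contDiff_kwonCutoff (n := 2)).fderiv_right (m := 1) le_rfl)
  have hWs : ContDiff ℝ 1 W := by
    have h1 : ContDiff ℝ 1 fun y => fderiv ℝ (curl (testPotential ξ)) y (gradient kwonCutoff y) :=
      (hcurlA2.fderiv_right (m := 1) le_rfl).clm_apply hgradφ
    have h2 : ContDiff ℝ 1 fun y => ((Δ kwonCutoff) y) • curl (testPotential ξ) y :=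
      (contDiff_laplacian (n := 1) (contDiff_kwonCutoff (n := 3))).smul
        (contDiff_curl_testPotential hξ)
    exact ((contDiff_const (c := (2 : ℝ))).smul h1).add h2
  have hWd : ∀ y, DifferentiableAt ℝ W y := fun y => (hWs.differentiable one_ne_zero) y
  -- `Δ(-curl F) = -curl (Δ F)`
  have hneg : (fun y => -curl F y) = (-1 : ℝ) • curl F := by
    funext y; simp
  have hcurlF2 : ContDiff ℝ 2 (curl F) := contDiff_curl hF3
  rw [hζ, hneg, InnerProductSpace.laplacian_smul (-1 : ℝ) hcurlF2.contDiffAt,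
    ← curl_laplacian hF3 x, hΔF, curl_add (hGd x) (hWd x), testField]
  simp only [neg_smul, one_smul, neg_add_rev]
  abel

/-! ### Space–time test fields: the slicewise potentials and test fields of `Ξ ∈ C_c^∞(ℝ × ℝ³; ℝ³)` -/

section SpaceTime

variable {Ξ : ℝ → EuclideanSpace ℝ (Fin 3) → EuclideanSpace ℝ (Fin 3)}

/-- **Joint smoothness of the slicewise potential** `(t, x) ↦ A_{Ξ(t,·)}(x)` of a space–time
test field (Mathlib's `contDiffOn_convolution_right_with_param` with the time as parameter: the
kernel is `L¹_loc`, `Ξ` is jointly smooth with `x`-supports in a fixed compact set). [folklore] -/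
theorem contDiff_uncurry_testPotential_slice
    (hΞ : IsSpaceTimeTestOn (⊤ : Opens (ℝ × EuclideanSpace ℝ (Fin 3))) Ξ) :
    ContDiff ℝ ∞ (uncurry fun t => testPotential (Ξ t)) := by
  obtain ⟨K, hK, hKt⟩ := hΞ.exists_compact_slice_subset
  have hgs : ∀ (t : ℝ) (x : EuclideanSpace ℝ (Fin 3)), t ∈ (univ : Set ℝ) → x ∉ K → Ξ t x = 0 :=
    fun t x _ hx => image_eq_zero_of_notMem_tsupport fun h => hx (hKt t h)
  have h := contDiffOn_convolution_right_with_param (𝕜 := ℝ) (n := (⊤ : ℕ∞))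
    (lsmul ℝ ℝ) (g := Ξ) isOpen_univ hK hgs integrable_testKernel.locallyIntegrable
    (by rw [univ_prod_univ]; exact hΞ.contDiff.contDiffOn)
  rw [univ_prod_univ, contDiffOn_univ] at h
  have hfun : (uncurry fun t => testPotential (Ξ t)) =
      fun q : ℝ × EuclideanSpace ℝ (Fin 3) => (testKernel ⋆[lsmul ℝ ℝ, volume] Ξ q.1) q.2 := by
    funext q; rfl
  rw [hfun]
  exact h

/-- The slicewise potential is a jointly smooth space–time field (all of `ℝ` in time). [folklore] -/
theorem isSmoothSpaceTimeOn_testPotential_slice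
    (hΞ : IsSpaceTimeTestOn (⊤ : Opens (ℝ × EuclideanSpace ℝ (Fin 3))) Ξ) :
    IsSmoothSpaceTimeOn univ (fun t => testPotential (Ξ t)) := by
  rw [IsSmoothSpaceTimeOn, univ_prod_univ]
  exact (contDiff_uncurry_testPotential_slice hΞ).contDiffOn

/-- **The time derivative falls on the test field**: `∂ₜ A_{Ξ(t,·)}(x) = A_{∂ₜΞ(t,·)}(x)`
(differentiation under the integral sign, dominated by `|N(z)| · sup |∂ₜΞ|`). [folklore] -/
theorem hasDerivAt_testPotential_slice
    (hΞ : IsSpaceTimeTestOn (⊤ : Opens (ℝ × EuclideanSpace ℝ (Fin 3))) Ξ) (t : ℝ)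
    (x : EuclideanSpace ℝ (Fin 3)) :
    HasDerivAt (fun s => testPotential (Ξ s) x) (testPotential (timeDeriv Ξ t) x) t := by
  have hΞ' := hΞ.timeDeriv_top
  obtain ⟨M, -, hM⟩ := hΞ'.exists_norm_le
  have hkρ : ∀ z : EuclideanSpace ℝ (Fin 3), (4 : ℝ) < ‖z‖ → testKernel z = 0 :=
    fun z hz => testKernel_eq_zero_of_lt hz
  have hF_int : ∀ s, Integrable fun z => testKernel z • Ξ s (x - z) := fun s =>
    integrable_smul_comp_sub integrable_testKernel hkρ (hΞ.contDiff_slice s).continuous x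
  have hF'_int : ∀ s, Integrable fun z => testKernel z • timeDeriv Ξ s (x - z) := fun s =>
    integrable_smul_comp_sub integrable_testKernel hkρ (hΞ'.contDiff_slice s).continuous x
  have hdiff : ∀ (z : EuclideanSpace ℝ (Fin 3)) (s : ℝ),
      HasDerivAt (fun r => testKernel z • Ξ r (x - z)) (testKernel z • timeDeriv Ξ s (x - z)) s := by
    intro z s
    have hd : HasFDerivAt (uncurry Ξ) (fderiv ℝ (uncurry Ξ) (s, x - z)) (s, x - z) :=
      ((hΞ.contDiff.differentiable (by simp)) _).hasFDerivAt
    have h1 := hasDerivAt_timeLine hd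
    have h2 : HasDerivAt (fun r => Ξ r (x - z)) (timeDeriv Ξ s (x - z)) s := by
      rw [timeDeriv_apply, h1.deriv]; exact h1
    exact h2.const_smul (testKernel z)
  have h := (hasDerivAt_integral_of_dominated_loc_of_deriv_le (μ := volume)
    (F := fun s z => testKernel z • Ξ s (x - z))
    (F' := fun s z => testKernel z • timeDeriv Ξ s (x - z)) (x₀ := t)
    (bound := fun z => ‖testKernel z‖ * M) (s := univ) univ_mem
    (Eventually.of_forall fun s => (hF_int s).aestronglyMeasurable) (hF_int t)
    (hF'_int t).aestronglyMeasurable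
    (Eventually.of_forall fun z s _ => by
      rw [norm_smul]
      exact mul_le_mul_of_nonneg_left (hM _ _) (norm_nonneg _))
    (integrable_testKernel.norm.mul_const M)
    (Eventually.of_forall fun z s _ => hdiff z s)).2
  have e1 : (fun s => ∫ z, testKernel z • Ξ s (x - z)) = fun s => testPotential (Ξ s) x :=
    funext fun s => (testPotential_eq_integral (Ξ s) x).symm
  rw [e1, ← testPotential_eq_integral] at h
  exact h

/-- `∂ₜ A_{Ξ(t,·)} = A_{∂ₜΞ(t,·)}` (time derivative as `timeDeriv`). [folklore] -/
theorem timeDeriv_testPotential_slice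
    (hΞ : IsSpaceTimeTestOn (⊤ : Opens (ℝ × EuclideanSpace ℝ (Fin 3))) Ξ) (t : ℝ)
    (x : EuclideanSpace ℝ (Fin 3)) :
    timeDeriv (fun t => testPotential (Ξ t)) t x = testPotential (timeDeriv Ξ t) x :=
  (hasDerivAt_testPotential_slice hΞ t x).deriv

/-- Function form of `timeDeriv_testPotential_slice`. [folklore] -/
theorem deriv_testPotential_slice_eq
    (hΞ : IsSpaceTimeTestOn (⊤ : Opens (ℝ × EuclideanSpace ℝ (Fin 3))) Ξ) (t : ℝ) :
    (fun y => deriv (fun s => testPotential (Ξ s) y) t) = testPotential (timeDeriv Ξ t) :=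
  funext fun y => (hasDerivAt_testPotential_slice hΞ t y).deriv

/-- The slicewise field `(t, y) ↦ φ(y) curl A_{Ξ(t,·)}(y)` is jointly smooth. [folklore] -/
theorem isSmoothSpaceTimeOn_smul_curl_testPotential_slice
    (hΞ : IsSpaceTimeTestOn (⊤ : Opens (ℝ × EuclideanSpace ℝ (Fin 3))) Ξ) :
    IsSmoothSpaceTimeOn univ (fun t y => kwonCutoff y • curl (testPotential (Ξ t)) y) := by
  have hDA := (isSmoothSpaceTimeOn_testPotential_slice hΞ).isSmoothSpaceTimeOn_fderiv_of_isOpen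
    isOpen_univ
  have hcurl : IsSmoothSpaceTimeOn univ (fun t y => curl (testPotential (Ξ t)) y) := by
    have h := hDA.clm curlCLM
    simpa only [← curl_eq_curlCLM] using h
  exact (isSmoothSpaceTimeOn_const_time contDiff_kwonCutoff univ).smul hcurl

/-- **Joint smoothness of the slicewise test field** `(t, x) ↦ ζ_{Ξ(t,·)}(x)`. [folklore] -/
theorem isSmoothSpaceTimeOn_testField_slice
    (hΞ : IsSpaceTimeTestOn (⊤ : Opens (ℝ × EuclideanSpace ℝ (Fin 3))) Ξ) :
    IsSmoothSpaceTimeOn univ (fun t => testField (Ξ t)) := by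
  have hDF := (isSmoothSpaceTimeOn_smul_curl_testPotential_slice hΞ).isSmoothSpaceTimeOn_fderiv_of_isOpen
    isOpen_univ
  have h := (hDF.clm curlCLM).neg
  have e : uncurry (fun t => testField (Ξ t)) = fun q : ℝ × EuclideanSpace ℝ (Fin 3) =>
      -uncurry (fun t y => curlCLM (fderiv ℝ
        (fun y => kwonCutoff y • curl (testPotential (Ξ t)) y) y)) q := by
    funext q
    simp only [uncurry, testField, curl_eq_curlCLM]
  rw [IsSmoothSpaceTimeOn, e]
  exact h

/-- The slicewise test field is jointly `C^∞` on `ℝ × ℝ³`. [folklore] -/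
theorem contDiff_uncurry_testField_slice
    (hΞ : IsSpaceTimeTestOn (⊤ : Opens (ℝ × EuclideanSpace ℝ (Fin 3))) Ξ) :
    ContDiff ℝ ∞ (uncurry fun t => testField (Ξ t)) := by
  have h := isSmoothSpaceTimeOn_testField_slice hΞ
  rw [IsSmoothSpaceTimeOn, univ_prod_univ, contDiffOn_univ] at h
  exact h

/-- **The time derivative falls on the test field**: `∂ₜ ζ_{Ξ(t,·)}(x) = ζ_{∂ₜΞ(t,·)}(x)`
(exchange of `∂ₜ` with the spatial derivatives of the jointly smooth potential, Schwarz, and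
`∂ₜ A_{Ξ(t,·)} = A_{∂ₜΞ(t,·)}`). [folklore] -/
theorem hasDerivAt_testField_slice
    (hΞ : IsSpaceTimeTestOn (⊤ : Opens (ℝ × EuclideanSpace ℝ (Fin 3))) Ξ) (t : ℝ)
    (x : EuclideanSpace ℝ (Fin 3)) :
    HasDerivAt (fun s => testField (Ξ s) x) (testField (timeDeriv Ξ t) x) t := by
  have hA := isSmoothSpaceTimeOn_testPotential_slice hΞ
  have hF := isSmoothSpaceTimeOn_smul_curl_testPotential_slice hΞ
  -- (1) `d/ds D(A_{Ξ s})(y) = D(A_{∂ₜΞ t})(y)`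
  have h1 : ∀ y, HasDerivAt (fun s => fderiv ℝ (testPotential (Ξ s)) y)
      (fderiv ℝ (testPotential (timeDeriv Ξ t)) y) t := fun y => by
    have h := hA.hasDerivAt_fderiv_slice_clm isOpen_univ (mem_univ t) y
    rwa [deriv_testPotential_slice_eq hΞ t] at h
  -- (2) `d/ds (φ(y) curl A_{Ξ s}(y)) = φ(y) curl A_{∂ₜΞ t}(y)`
  have h2 : ∀ y, HasDerivAt (fun s => kwonCutoff y • curl (testPotential (Ξ s)) y)
      (kwonCutoff y • curl (testPotential (timeDeriv Ξ t)) y) t := fun y => by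
    have h := (curlCLM.hasFDerivAt.comp_hasDerivAt t (h1 y)).const_smul (kwonCutoff y)
    simpa only [Function.comp_def, ← curl_eq_curlCLM, Pi.smul_def] using h
  have h2' : (fun y => deriv (fun s => kwonCutoff y • curl (testPotential (Ξ s)) y) t) =
      fun y => kwonCutoff y • curl (testPotential (timeDeriv Ξ t)) y :=
    funext fun y => (h2 y).deriv
  -- (3) `d/ds D(φ curl A_{Ξ s})(x)`, (4) compose with `-curlCLM`
  have h3 := hF.hasDerivAt_fderiv_slice_clm isOpen_univ (mem_univ t) x
  rw [h2'] at h3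
  have h4 := (curlCLM.hasFDerivAt.comp_hasDerivAt t h3).neg
  simpa only [Function.comp_def, testField, ← curl_eq_curlCLM, Pi.neg_def] using h4

/-- `∂ₜ ζ_{Ξ(t,·)} = ζ_{∂ₜΞ(t,·)}` (time derivative as `timeDeriv`). [folklore] -/
theorem timeDeriv_testField_slice
    (hΞ : IsSpaceTimeTestOn (⊤ : Opens (ℝ × EuclideanSpace ℝ (Fin 3))) Ξ) (t : ℝ)
    (x : EuclideanSpace ℝ (Fin 3)) :
    timeDeriv (fun t => testField (Ξ t)) t x = testField (timeDeriv Ξ t) x :=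
  (hasDerivAt_testField_slice hΞ t x).deriv

/-! ### Supports -/

/-- A slice on which `Ξ(t, ·) ≡ 0` produces the zero test field. [folklore] -/
theorem testField_slice_eq_zero_of_forall {t : ℝ} (h : ∀ y, Ξ t y = 0)
    (x : EuclideanSpace ℝ (Fin 3)) : testField (Ξ t) x = 0 := by
  have : Ξ t = 0 := funext h
  rw [this, testField_zero, Pi.zero_apply]

/-- **Support of the slicewise test field**: `ζ_{Ξ(t,·)}(x) ≠ 0` forces `t` to lie in the time
projection of `supp Ξ` and `|x| ≤ 7/4`. [folklore] -/
theorem tsupport_uncurry_testField_slice_subset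
    (hΞ : IsSpaceTimeTestOn (⊤ : Opens (ℝ × EuclideanSpace ℝ (Fin 3))) Ξ) :
    tsupport (uncurry fun t => testField (Ξ t)) ⊆
      (Prod.fst '' tsupport (uncurry Ξ)) ×ˢ closedBall (0 : EuclideanSpace ℝ (Fin 3)) (7 / 4) := by
  have hc : IsClosed ((Prod.fst '' tsupport (uncurry Ξ)) ×ˢ
      closedBall (0 : EuclideanSpace ℝ (Fin 3)) (7 / 4)) :=
    (hΞ.hasCompactSupport.image continuous_fst).isClosed.prod isClosed_closedBall
  refine closure_minimal (fun q hq => ?_) hc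
  obtain ⟨t, x⟩ := q
  refine ⟨?_, ?_⟩
  · by_contra hnot
    refine hq (testField_slice_eq_zero_of_forall (fun y => ?_) x)
    by_contra hne
    exact hnot ⟨(t, y), subset_tsupport _ hne, rfl⟩
  · rw [mem_closedBall_zero_iff]
    by_contra hlt
    exact hq (testField_eq_zero (not_le.1 hlt))

/-- The slicewise test field has compact support in space–time. [folklore] -/
theorem hasCompactSupport_uncurry_testField_slice
    (hΞ : IsSpaceTimeTestOn (⊤ : Opens (ℝ × EuclideanSpace ℝ (Fin 3))) Ξ) :
    HasCompactSupport (uncurry fun t => testField (Ξ t)) :=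
  IsCompact.of_isClosed_subset
    ((hΞ.hasCompactSupport.image continuous_fst).prod (isCompact_closedBall _ _))
    (isClosed_tsupport _) (tsupport_uncurry_testField_slice_subset hΞ)

/-- **The slicewise test field of a space–time test field is a space–time test field on
`ℝ × ℝ³`.** [folklore] -/
theorem isSpaceTimeTestOn_testField_slice_top
    (hΞ : IsSpaceTimeTestOn (⊤ : Opens (ℝ × EuclideanSpace ℝ (Fin 3))) Ξ) :
    IsSpaceTimeTestOn (⊤ : Opens (ℝ × EuclideanSpace ℝ (Fin 3))) (fun t => testField (Ξ t)) :=
  ⟨contDiff_uncurry_testField_slice hΞ, hasCompactSupport_uncurry_testField_slice hΞ, by simp⟩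

/-- **The slicewise test field of `Ξ ∈ C_c^∞((a,b) × U)` is a space–time test field on the
cylinder `(a, b) × B₂`** (its support lies in `(a, b) × B̄_{7/4}`) — Kwon's test fields
`−curl(φ curl Δ⁻¹ξ)`, `ξ ∈ C_c^∞((−4,0) × B₁)`, are admissible in the weak formulation on `Q₂`.
[cite: Kwon2023RolePressure, Lemma 2.5 (proof, p. 8)] -/
theorem isSpaceTimeTestOn_testField_slice {a b : ℝ} {U : Set (EuclideanSpace ℝ (Fin 3))}
    (hU : IsOpen U)
    (hΞ : IsSpaceTimeTestOn (⟨Ioo a b ×ˢ U, isOpen_Ioo.prod hU⟩ :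
      Opens (ℝ × EuclideanSpace ℝ (Fin 3))) Ξ) :
    IsSpaceTimeTestOn (⟨Ioo a b ×ˢ ball (0 : EuclideanSpace ℝ (Fin 3)) 2,
      isOpen_Ioo.prod isOpen_ball⟩ : Opens (ℝ × EuclideanSpace ℝ (Fin 3)))
      (fun t => testField (Ξ t)) := by
  have hΞ' : IsSpaceTimeTestOn (⊤ : Opens (ℝ × EuclideanSpace ℝ (Fin 3))) Ξ := hΞ.mono le_top
  refine ⟨contDiff_uncurry_testField_slice hΞ', hasCompactSupport_uncurry_testField_slice hΞ', ?_⟩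
  refine (tsupport_uncurry_testField_slice_subset hΞ').trans (prod_mono ?_ ?_)
  · rintro _ ⟨⟨t, y⟩, hty, rfl⟩
    exact (hΞ.tsupport_subset hty).1
  · exact closedBall_subset_ball (by norm_num)

end SpaceTime

end Kwon2023

end Literature.Analysis.FluidPDE

end
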